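import Summits.BirchSwinnertonDyer.BirchSwinnertonDyer.Theorems.PrintCFramBottomClassIndexLawFiveLeBorelGrossSurjectivity
import Summits.BirchSwinnertonDyer.BirchSwinnertonDyer.Theorems.PrintCFramBottomClassIndexLawFiveLeBorelUniserialLeaf
import Literature.NumberTheory.EllipticCurves.HeegnerPointsKolyvaginConjugation
import HarnessLib

/-!
# Route `PrintCFram`, crux C2 `BottomClassIndexLawFiveLe` (stmt-BirchSwinnertonDyer-20372), line
# `eisenstein-resource-bdp-line` (S2 `stub_kolyvaginUpper_borelCM_pairSum`, input (γ)):
# **Gross Prop. 9.3 at the Borel CM prime in the machine's currency** — the Kolyvagin evaluations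
# at classes independent modulo `W[𝔭]` are jointly surjective onto `W(K̄'')[p]^r`
# (cell `bsd-print-cfram`, seat `bsd-line-cfram-p1-w2` g5; helper `--supports` 20372; 0 facts, 0 defs)

HONEST FRAMING. Nothing about BSD is proved here, and nothing of S2 itself. File 8c transports the
uniseriality of `…BorelUniserialLeaf` (8b) along `θ = RatClosure.torsionEquiv : W(ℚ̄)[p] ≃ W(K̄'')[p]`
and feeds it to the uniserial Prop. 9.3 of `…BorelGrossSurjectivity` (8a):
* `finite_geomTorsion`, `finite_geomTorsion_baseChange` (`#E[p] = p²`);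
* `uniserial_geomTorsion_baseChange_of_cmRamified`: for `W/ℚ` CM, `p ≥ 5` CM-ramified, `μ = √−p`
  with its sign rule, `[K'' : ℚ] < p`: with `L = θ(ker μ ∩ W[p]) ≤ W(K̄'')[p]`
  (`t ∈ L ↔ μ(θ⁻¹ t) = 0`), `L` is `Γ_{K''}`-stable, `W(K̄'')[p]/L` is cyclic, and every
  `Γ_{K''}`-stable subgroup is `⊥`, `L` or `⊤`;
* END STATES `exists_h1Eval_eq_of_cmRamified`: classes `x₁, …, x_r ∈ H¹(K'', W[p])` whose
  evaluations are independent modulo `W[𝔭]` (`μ(θ⁻¹ ∑ aᵢ[xᵢ, ρ]) = 0 ∀ ρ ∈ Γ_{K''(W[p])} ⟹ p ∣ aᵢ`)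
  have `ρ ↦ ([xᵢ, ρ])ᵢ` ONTO `W(K̄'')[p]^r`; `exists_h1Eval_eq_of_cmRamified_one` (`r = 1`: one
  evaluation off the line ⟹ every value).
This replaces `exists_h1Eval_eq` (which needs `E[p]` simple with scalar commutant — both false here)
in Gross §9 / McCallum §3 for the class, over every `K''` of degree `< p` (Heegner fields,
`ℚ(√−p)`, the biquadratic `K·K''`). The hypothesis the `𝓞_𝔭`-bookkeeping of S2 must now supply is
«independence modulo `W[𝔭]`» — for one Kummer class `δP`: some `ρ ∈ Γ_{K''(W[p])}` moves a `p`-th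
root of `P` off `W[𝔭]`. THEOREMS ONLY; no definition, no named fact, no `sorry`. BSD is not proved
by any of this; no summit statement is proved by this seat.
References: [GrossLMS1991] §9 Prop. 9.3; [McCallumLMS1991] §3 (2); [Rubin1999] Cor. 5.5.
-/

set_option autoImplicit false
-- `…BirchSwinnertonDyer.BirchSwinnertonDyer.Theorems…` is the problem's mandated namespace (D-0017).
set_option linter.dupNamespace false

noncomputable section

open scoped Classical

namespace Summit.BirchSwinnertonDyer.BirchSwinnertonDyer.Theorems.PrintCFram.BorelKolyvaginPairing

open WeierstrassCurve Field Literature.NumberTheory.EllipticCurves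
  Literature.NumberTheory.EllipticCurves.KolyvaginPairing Literature.NumberTheory.GaloisRepresentations
  Literature.NumberTheory.EllipticCurves.Rank1Residual
  Summit.BirchSwinnertonDyer.BirchSwinnertonDyer.Theorems.PrintCFram.BorelHomothety
  Summit.BirchSwinnertonDyer.BirchSwinnertonDyer.Theorems.PrintCFram.BorelNonScalar

/-! ## §3 The leaf in the machine's currency (`E(K̄)[p]`, `Γ_K`) and the joint surjectivity -/

section Machine

variable (W : WeierstrassCurve ℚ) [W.IsElliptic] (p : ℕ) [hp : Fact p.Prime]
variable (K : Type) [Field K] [NumberField K]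

/-- `E(ℚ̄)[p]` is finite (`#E[p] = p²`). [folklore] -/
theorem finite_geomTorsion : Finite (W.geomTorsion (p : ℤ)) :=
  Nat.finite_of_card_ne_zero (by
    rw [W.natCard_geomTorsion_prime_eq_sq hp.out]; exact pow_ne_zero 2 hp.out.ne_zero)

/-- `E(K̄)[p]` is finite, along `RatClosure.torsionEquiv`. [folklore] -/
theorem finite_geomTorsion_baseChange : Finite (geomTorsion (W.baseChange K) (p : ℤ)) :=
  haveI := finite_geomTorsion W p
  Finite.of_equiv _ (RatClosure.torsionEquiv (K := K) W (p : ℤ)).toEquiv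

/-- **The three hypotheses of the uniserial Prop. 9.3 for `E(K̄)[p]` at the Borel CM prime.** For
`W/ℚ` with CM, `p ≥ 5` CM-ramified, `μ = √−p ∈ End W(ℚ̄)` with its Galois sign rule
(`exists_sqrt_end_of_cmRamified`), and a number field `K` with `[K : ℚ] < p`; write
`θ : W(ℚ̄)[p] ≃ W(K̄)[p]` (`RatClosure.torsionEquiv`) and `L = θ(ker μ ∩ W[p]) ≤ W(K̄)[p]`
(membership: `t ∈ L ↔ μ (θ⁻¹ t) = 0`). Then `L` is `Γ_K`-stable, `W(K̄)[p]/L` is cyclic, and every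
`Γ_K`-stable subgroup of `W(K̄)[p]` is `⊥`, `L` or `⊤`. [cite: Rubin1999, Cor. 5.5] [cite: GrossLMS1991, Prop. 9.3] -/
theorem uniserial_geomTorsion_baseChange_of_cmRamified (hCM : W.HasCM) (h5 : 5 ≤ p)
    (hram : CMRamified W p) {s : AlgebraicClosure ℚ} {μ : AddMonoid.End W.geomPoints} {m : ℤ}
    (hs : s ^ 2 = ((-(p : ℤ) : ℤ) : AlgebraicClosure ℚ)) (hm : m.natAbs = p)
    (hμμ : ∀ P, μ (μ P) = m • P) (hcomm : ∀ g : absoluteGaloisGroup ℚ, g • s = s → ∀ P, μ (g • P) = g • μ P)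
    (hanti : ∀ g : absoluteGaloisGroup ℚ, g • s = -s → ∀ P, μ (g • P) = -(g • μ P))
    (hK : Module.finrank ℚ K < p) :
    ∃ (L : AddSubgroup (geomTorsion (W.baseChange K) (p : ℤ))) (t₀ : geomTorsion (W.baseChange K) (p : ℤ)),
      (∀ t, t ∈ L ↔ μ ((RatClosure.torsionEquiv (K := K) W (p : ℤ)).symm t : W.geomTorsion (p : ℤ)) = 0) ∧
      (∀ g : absoluteGaloisGroup K, ∀ t ∈ L, g • t ∈ L) ∧
      (∀ t, ∃ k : ℤ, t - k • t₀ ∈ L) ∧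
      ∀ H : AddSubgroup (geomTorsion (W.baseChange K) (p : ℤ)),
        (∀ g : absoluteGaloisGroup K, ∀ t ∈ H, g • t ∈ H) → H = ⊥ ∨ H = L ∨ H = ⊤ := by
  have hpr : p.Prime := hp.out
  set θ := RatClosure.torsionEquiv (K := K) W (p : ℤ) with hθ
  set μ' : W.geomPoints →+ W.geomPoints := μ with hμ'
  -- the line on the `ℚ̄` side, as a subgroup of the subtype `W[p]`
  set L₀ : AddSubgroup (W.geomTorsion (p : ℤ)) := μ'.ker.addSubgroupOf (W.geomTorsion (p : ℤ)) with hL₀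
  have hmemL₀ : ∀ t : W.geomTorsion (p : ℤ), t ∈ L₀ ↔ μ (t : W.geomPoints) = 0 := fun t => by
    rw [hL₀, AddSubgroup.mem_addSubgroupOf, AddMonoidHom.mem_ker]; rfl
  set L : AddSubgroup (geomTorsion (W.baseChange K) (p : ℤ)) := L₀.map θ.toAddMonoidHom with hL
  have hmemL : ∀ t, t ∈ L ↔ μ ((θ.symm t : W.geomTorsion (p : ℤ)) : W.geomPoints) = 0 := fun t => by
    rw [hL, AddSubgroup.mem_map]
    constructor
    · rintro ⟨t₀, ht₀, rfl⟩
      rw [AddEquiv.coe_toAddMonoidHom, θ.symm_apply_apply]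
      exact (hmemL₀ t₀).mp ht₀
    · intro ht
      exact ⟨θ.symm t, (hmemL₀ _).mpr ht, by rw [AddEquiv.coe_toAddMonoidHom, θ.apply_symm_apply]⟩
  -- generator pair and the base point `t₀ = θ v`
  have hne := exists_mem_geomTorsion_apply_ne_zero W p hμμ hm
  obtain ⟨v, hv, hgen⟩ := exists_generator_pair μ' hμμ hm hpr (W.natCard_geomTorsion_prime_eq_sq hpr)
    hne (M := 1) le_rfl (by simpa using W.natCard_geomTorsion_prime_eq_sq hpr)
  simp only [pow_one] at hv hgen
  refine ⟨L, θ ⟨v, hv⟩, hmemL, fun g t ht => ?_, fun t => ?_, fun H hH => ?_⟩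
  · -- `Γ_K`-stability
    rw [hmemL] at ht ⊢
    obtain ⟨t₁, rfl⟩ := θ.surjective t
    rw [← RatClosure.torsionEquiv_smul, θ.symm_apply_apply]
    rw [θ.symm_apply_apply] at ht
    exact smul_mem_ker_of_mem_ker W p hs hcomm hanti (absGaloisRestrict ℚ K g) (P := (t₁ : W.geomPoints)) ht
  · -- cyclicity of the quotient
    obtain ⟨t₁, rfl⟩ := θ.surjective t
    obtain ⟨k, hk⟩ := exists_sub_zsmul_mem_ker μ' hμμ hm hv hgen t₁.2
    refine ⟨k, ?_⟩
    rw [hmemL, ← map_zsmul, ← map_sub, θ.symm_apply_apply]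
    exact hk
  · -- trichotomy, transported from the `ℚ̄` side
    set H₀ : AddSubgroup (W.geomTorsion (p : ℤ)) := H.comap θ.toAddMonoidHom with hH₀
    set H₁ : AddSubgroup W.geomPoints := H₀.map (W.geomTorsion (p : ℤ)).subtype with hH₁
    have hH₁le : H₁ ≤ W.geomTorsion (p : ℤ) := AddSubgroup.map_subtype_le _
    have hH₁stab : ∀ g : absoluteGaloisGroup K, ∀ P ∈ H₁, absGaloisRestrict ℚ K g • P ∈ H₁ := by
      rintro g P ⟨t, ht, rfl⟩
      refine ⟨absGaloisRestrict ℚ K g • t, ?_, rfl⟩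
      change θ t ∈ H at ht
      change θ (absGaloisRestrict ℚ K g • t) ∈ H
      rw [RatClosure.torsionEquiv_smul]
      exact hH g _ ht
    have hHH₀ : H = H₀.map θ.toAddMonoidHom := by
      rw [hH₀, AddSubgroup.map_comap_eq_self_of_surjective]
      exact θ.surjective
    have hH₀H₁ : H₀ = H₁.addSubgroupOf (W.geomTorsion (p : ℤ)) := by
      rw [hH₁]
      change H₀ = AddSubgroup.comap (W.geomTorsion (p : ℤ)).subtype
        (AddSubgroup.map (W.geomTorsion (p : ℤ)).subtype H₀)
      rw [AddSubgroup.comap_map_eq_self_of_injective (W.geomTorsion (p : ℤ)).subtype_injective]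
    rcases eq_bot_or_eq_ker_or_eq_geomTorsion_of_cmRamified W p hCM h5 hram hs hm hμμ hcomm K hK hH₁le
      hH₁stab with h | h | h
    · left
      rw [hHH₀, hH₀H₁, h, AddSubgroup.bot_addSubgroupOf, AddSubgroup.map_bot]
    · right; left
      rw [hHH₀, hH₀H₁, h]
    · right; right
      rw [hHH₀, hH₀H₁, h, AddSubgroup.addSubgroupOf_self, AddSubgroup.map_top_of_surjective]
      exact θ.surjective

/-- **END STATE (γ): joint surjectivity of the Kolyvagin evaluations at the Borel CM prime.** `W/ℚ`
with CM, `p ≥ 5` CM-ramified, `μ = √−p ∈ End W(ℚ̄)` with its sign rule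
(`exists_sqrt_end_of_cmRamified`), `K` a number field with `[K : ℚ] < p` (every quadratic Heegner
field, `ℚ(√−p)`, the biquadratic `K·K''`). If `x₁, …, x_r ∈ H¹(K, W[p])` have evaluations
independent MODULO THE LINE `W[𝔭] = ker μ` — whenever `μ(θ⁻¹ ∑ aᵢ [xᵢ, ρ]) = 0` for all
`ρ ∈ Γ_{K(W[p])}` then `p ∣ aᵢ` for all `i` — then `ρ ↦ ([xᵢ, ρ])ᵢ` maps `Γ_{K(W[p])}` ONTO
`W(K̄)[p]^r`. This is what replaces `exists_h1Eval_eq` (which needs `E[p]` simple) in Gross §9 /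
McCallum §3 for the class. [cite: GrossLMS1991, Prop. 9.3] [cite: McCallumLMS1991, §3 (2)] -/
theorem exists_h1Eval_eq_of_cmRamified (hCM : W.HasCM) (h5 : 5 ≤ p)
    (hram : CMRamified W p) {s : AlgebraicClosure ℚ} {μ : AddMonoid.End W.geomPoints} {m : ℤ}
    (hs : s ^ 2 = ((-(p : ℤ) : ℤ) : AlgebraicClosure ℚ)) (hm : m.natAbs = p)
    (hμμ : ∀ P, μ (μ P) = m • P) (hcomm : ∀ g : absoluteGaloisGroup ℚ, g • s = s → ∀ P, μ (g • P) = g • μ P)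
    (hanti : ∀ g : absoluteGaloisGroup ℚ, g • s = -s → ∀ P, μ (g • P) = -(g • μ P))
    (hK : Module.finrank ℚ K < p) {r : ℕ} (xs : Fin r → galH1Torsion (W.baseChange K) (p : ℤ))
    (hind : ∀ a : Fin r → ℤ,
      (∀ ρ ∈ torsionFixing (W.baseChange K) (p : ℤ),
        μ ((RatClosure.torsionEquiv (K := K) W (p : ℤ)).symm
          (∑ i, a i • h1Eval (W.baseChange K) (p : ℤ) (xs i) ρ) : W.geomTorsion (p : ℤ)) = 0) →
        ∀ i, (p : ℤ) ∣ a i)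
    (e : Fin r → geomTorsion (W.baseChange K) (p : ℤ)) :
    ∃ ρ ∈ torsionFixing (W.baseChange K) (p : ℤ), ∀ i, h1Eval (W.baseChange K) (p : ℤ) (xs i) ρ = e i := by
  haveI := finite_geomTorsion_baseChange W p K
  obtain ⟨L, t₀, hmemL, hL, hcyc, hS⟩ :=
    uniserial_geomTorsion_baseChange_of_cmRamified W p K hCM h5 hram hs hm hμμ hcomm hanti hK
  exact exists_h1Eval_eq_of_indep_modLine (W.baseChange K) hp.out L hL hcyc hS xs
    (fun a ha => hind a fun ρ hρ => (hmemL _).mp (ha ρ hρ)) e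

/-- **`r = 1`.** Same setting: a class `x ∈ H¹(K, W[p])` with ONE evaluation off the line
(`μ(θ⁻¹[x, ρ₀]) ≠ 0` for some `ρ₀ ∈ Γ_{K(W[p])}`) takes every value of `W(K̄)[p]`.
[cite: GrossLMS1991, Prop. 9.3] -/
theorem exists_h1Eval_eq_of_cmRamified_one (hCM : W.HasCM) (h5 : 5 ≤ p)
    (hram : CMRamified W p) {s : AlgebraicClosure ℚ} {μ : AddMonoid.End W.geomPoints} {m : ℤ}
    (hs : s ^ 2 = ((-(p : ℤ) : ℤ) : AlgebraicClosure ℚ)) (hm : m.natAbs = p)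
    (hμμ : ∀ P, μ (μ P) = m • P) (hcomm : ∀ g : absoluteGaloisGroup ℚ, g • s = s → ∀ P, μ (g • P) = g • μ P)
    (hanti : ∀ g : absoluteGaloisGroup ℚ, g • s = -s → ∀ P, μ (g • P) = -(g • μ P))
    (hK : Module.finrank ℚ K < p) (x : galH1Torsion (W.baseChange K) (p : ℤ))
    {ρ₀ : absoluteGaloisGroup K} (hρ₀ : ρ₀ ∈ torsionFixing (W.baseChange K) (p : ℤ))
    (hx : μ ((RatClosure.torsionEquiv (K := K) W (p : ℤ)).symm
      (h1Eval (W.baseChange K) (p : ℤ) x ρ₀) : W.geomTorsion (p : ℤ)) ≠ 0)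
    (e : geomTorsion (W.baseChange K) (p : ℤ)) :
    ∃ ρ ∈ torsionFixing (W.baseChange K) (p : ℤ), h1Eval (W.baseChange K) (p : ℤ) x ρ = e := by
  haveI := finite_geomTorsion_baseChange W p K
  obtain ⟨L, t₀, hmemL, hL, hcyc, hS⟩ :=
    uniserial_geomTorsion_baseChange_of_cmRamified W p K hCM h5 hram hs hm hμμ hcomm hanti hK
  exact exists_h1Eval_eq_of_not_mem (W.baseChange K) hp.out L hL hcyc hS
    (fun t => Subtype.ext (by rw [AddSubgroupClass.coe_zsmul]; exact t.2)) x hρ₀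
    (fun h => hx ((hmemL _).mp h)) e

end Machine

end Summit.BirchSwinnertonDyer.BirchSwinnertonDyer.Theorems.PrintCFram.BorelKolyvaginPairing

end
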